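import Literature.AlgebraicGeometry.HodgeTheory.QuaternionicQuarticDeckChartBaseChange
import Mathlib.AlgebraicGeometry.PullbackCarrier
import HarnessLib

/-!
# Non-empty base-changed deck chart ⇒ `DeckRing X_S ≠ 0`

Layer `Literature/AlgebraicGeometry/HodgeTheory`. Theorems only; no named fact. Written by the prover seat
`hodge-nonav-19716-p2` (g13, cell `hodge-nonav`) for prover-Bx's `Q8FamilyDeck_birational` (route `HodgeConjecture/Q8SymplecticPowers`,
stmt-HodgeConjecture-24190): the hypothesis `Nontrivial (DeckRing X_L)` of `birationalOver_deckChart_fiberSch` /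
`birationalOver_deckChart_of_isHypersurfaceCutOutBy` (`QuaternionicQuarticDeckChartBirational`) is discharged from clause (vi)
«the chart meets every fibre»: a point of `deckChart X` over a point in the image of `Spec S → Spec R` gives a point of
`(deckChart X ⊗ Spec S).left` (`nonempty_tensor_left_of_mem_range`, Mathlib `Scheme.Pullback.range_fst`), hence — through
prover-Bx's `deckChartTensorLeftIso` — a prime of `DeckRing X_S`, so that ring is non-zero (`nontrivial_deckRing_of_nonempty_tensor`,
`nontrivial_deckRing_of_mem_range`).

Honest scope: point-set bookkeeping; nothing here bears on HC.

## References

* [GortzWedhorn2020] U. Görtz, T. Wedhorn, Algebraic Geometry I, 2nd ed. (2020), Lemma 4.28, Prop. 4.18.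
* [AtiyahMacdonald1969] M. F. Atiyah, I. G. Macdonald, Introduction to Commutative Algebra (1969), Thm. 1.3.
-/

noncomputable section

set_option backward.isDefEq.respectTransparency false

open CategoryTheory CategoryTheory.Limits AlgebraicGeometry MvPolynomial HomogeneousLocalization TopologicalSpace MonoidalCategory
  CartesianMonoidalCategory TensorProduct
open Literature.AlgebraicGeometry.Motives Literature.AlgebraicGeometry.Motives.UniversalHypersurface

namespace Literature.AlgebraicGeometry.HodgeTheory.Q8Family

section NonEmptyChart

universe v

/-- A point of `X` lying over a point in the image of `Y → B` gives a point of `X ×_B Y` (Mathlib `Scheme.Pullback.range_fst`).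
[cite: GortzWedhorn2020, Lemma 4.28] -/
theorem nonempty_tensor_left_of_mem_range {B : Scheme.{v}} {X Y : Over B} (x : ↥X.left)
    (hx : X.hom x ∈ Set.range Y.hom) : Nonempty ↥(X ⊗ Y).left := by
  have h : x ∈ Set.range (pullback.fst X.hom Y.hom) := by
    rw [Scheme.Pullback.range_fst]
    exact hx
  obtain ⟨z, -⟩ := h
  exact ⟨z⟩

variable {R : Type v} [CommRing R] (S : Type v) [CommRing S] [Algebra R S] {e : ℕ} (a : CIdx e → R)

/-- **Non-empty base-changed deck chart ⇒ `DeckRing X_S ≠ 0`**: through prover-Bx's `deckChartTensorLeftIso`, a point of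
`(deckChart X ⊗ Spec S).left` is a prime of `DeckRing X_S`, which is therefore a non-zero ring. [cite: AtiyahMacdonald1969, Thm. 1.3] -/
theorem nontrivial_deckRing_of_nonempty_tensor (h : Nonempty ↥(deckChart a ⊗ specOver R S).left) :
    Nontrivial (DeckRing (algebraMap R S ∘ a)) := by
  obtain ⟨z⟩ := h
  have p : PrimeSpectrum (DeckRing (algebraMap R S ∘ a)) := (deckChartTensorLeftIso S a).hom z
  exact ⟨⟨0, 1, fun h01 => p.2.ne_top ((Ideal.eq_top_iff_one _).mpr (h01 ▸ p.asIdeal.zero_mem))⟩⟩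

/-- **A point of `deckChart X` over the image of `Spec S → Spec R` makes `DeckRing X_S` non-zero** (the form clause (vi) «the chart
meets every fibre» is consumed in). [cite: GortzWedhorn2020, Lemma 4.28] [cite: AtiyahMacdonald1969, Thm. 1.3] -/
theorem nontrivial_deckRing_of_mem_range (x : ↥(deckChart a).left)
    (hx : (deckChart a).hom x ∈ Set.range (specOver R S).hom) : Nontrivial (DeckRing (algebraMap R S ∘ a)) :=
  nontrivial_deckRing_of_nonempty_tensor S a (nonempty_tensor_left_of_mem_range x hx)

/-- The same at a ring map `φ : R → S` (e.g. a complex point `φ : A → ℂ`), `Spec φ` in place of the structure map.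
[cite: GortzWedhorn2020, Lemma 4.28] [cite: AtiyahMacdonald1969, Thm. 1.3] -/
theorem nontrivial_deckRing_of_mem_range_specMap {S' : Type v} [CommRing S'] (φ : R →+* S') (x : ↥(deckChart a).left)
    (hx : (deckChart a).hom x ∈ Set.range (Spec.map (CommRingCat.ofHom φ))) : Nontrivial (DeckRing (fun i => φ (a i))) :=
  letI : Algebra R S' := φ.toAlgebra
  nontrivial_deckRing_of_mem_range S' a x hx

end NonEmptyChart

end Literature.AlgebraicGeometry.HodgeTheory.Q8Family

end
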